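import Literature.Probability.Percolation.CrossoverCoupling
import HarnessLib

/-!
# Wierman's `p_c^site(ℤ²) ≤ 0.679492` (named fact) and the site entries `d = 4, 5, 8` of
# Gomes–Pereira–Sanchis's table conditional on it

Topic `Literature/Probability/Percolation`; one NAMED FACT (an unproved published theorem stated as a
`Prop`) and theorems CONDITIONAL on it (no `sorry`).

J. C. Wierman (*Substitution method critical probability bounds for the square lattice site percolation
model*, Combin. Probab. Comput. 4 (1995) 181–188) proves by the substitution method (stochastic ordering
of the boundary-partition laws of finite pieces, Bollobás–Riordan 2006, §6.1, Theorem 3: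
*"The critical probability `p_c^s(ℤ²)` for site percolation on the square lattice satisfies
`p_c^s(ℤ²) ≤ 0.679492`"*).  The substitution method is not in the tree; the statement is recorded here as
the named fact `Wierman1995SquareSite` (users take it as a hypothesis).

Gomes–Pereira–Sanchis (J. Appl. Probab. 63 (2026) 61–72, Theorem 3 and §5) deduce from it (rounded to
`0.68`) the site bounds `p_c^s(4) ≤ 1 - 0.32^{1/2} = 0.4344` (Lemma 2, `k = 2`) and `p_c^s(5) ≤ 0.4156`
(Proposition 4 from `d = 4`).  With the tree's kernel versions of Lemma 2
(`AxisGrouping.siteCriticalProb_zd_mul_le_real`) and Proposition 4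
(`GPSCrossover.siteCriticalProb_zd_succ_le_of_crossover`) we obtain, CONDITIONALLY on the named fact:

* `siteCriticalProb_zd4_le_of_wierman`: **`p_c^site(ℤ⁴) ≤ 0.4339`** (`1 - √0.320508 = 0.43386…`; the
  printed `0.4344` uses `0.68`);
* `siteCriticalProb_zd5_le_of_wierman`: **`p_c^site(ℤ⁵) ≤ 0.4153`** (printed `0.4156`);
* `siteCriticalProb_zd_two_mul_le_of_wierman`: **`p_c^site(ℤ^{2m}) ≤ 1 - 0.320508^{1/m}`** (Theorem 3(1),
  `p_c^s(d) ≤ 1 - 0.32^{2/d}` for even `d`), and `siteCriticalProb_zd8_le_of_wierman`: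
  **`p_c^site(ℤ⁸) ≤ 0.2476`** (printed `0.2479`).

The unconditional kernel bounds are `0.4685`, `0.4477` and `0.271` (`CrossoverCoupling.lean`).

## References

* [Wierman1995] J. C. Wierman, Combin. Probab. Comput. 4 (1995) 181–188, main theorem.
* [GomesPereiraSanchis2026] P. A. Gomes, A. Pereira, R. Sanchis, J. Appl. Probab. 63 (2026) 61–72,
  Lemma 2, Theorem 3(1),(3), §4.3 ("Wierman's upper bound `p_c^s(2) ≤ 0.68` (see [W2])"), §5 table.
-/

noncomputable section

namespace Literature.Probability.Percolation

open LatticeModels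

/-- **Wierman 1995** (named fact, not proved in the tree): the site percolation threshold of the square
lattice satisfies `p_c^site(ℤ²) ≤ 0.679492` (substitution method).
[cite: Wierman1995, main theorem (p_c^s(ℤ²) ≤ 0.679492)] -/
def Wierman1995SquareSite : Prop :=
  siteCriticalProb (zdGraph 2) (0 : Site 2) ≤ 0.679492

namespace GPSCrossover

/-- **`p_c^site(ℤ⁴) ≤ 0.4339`, conditional on Wierman's bound** (Gomes–Pereira–Sanchis, Theorem 3(1):
`p_c^s(d) ≤ 1 - 0.32^{2/d}` for even `d`; here with `0.320508` in place of `0.32`).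
[cite: GomesPereiraSanchis2026, Theorem 3(1) and §5 table (site, d = 4: 0.4344)] -/
theorem siteCriticalProb_zd4_le_of_wierman (hW : Wierman1995SquareSite) :
    siteCriticalProb (zdGraph 4) (0 : Site 4) ≤ 0.4339 := by
  have h := AxisGrouping.siteCriticalProb_zd_mul_le_real (k := 2) (m := 2) (t₀ := 0.4339) (by norm_num)
    fun t ht _ => by
      have hW' : siteCriticalProb (zdGraph 2) (0 : Site 2) ≤ 0.679492 := hW
      nlinarith
  exact h

/-- **`p_c^site(ℤ⁵) ≤ 0.4153`, conditional on Wierman's bound** (Gomes–Pereira–Sanchis, Theorem 3(3)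
from `d = 4`; crossover coupling with `q = 0.0738`, `7` copies, detours of height `≤ 5`).
[cite: GomesPereiraSanchis2026, Theorem 3(3) and §5 table (site, d = 5: 0.4156)] -/
theorem siteCriticalProb_zd5_le_of_wierman (hW : Wierman1995SquareSite) :
    siteCriticalProb (zdGraph 5) (0 : Site 5) ≤ 0.4153 := by
  have hq : (0.0738 : ℝ) ∈ unitInterval := ⟨by norm_num, by norm_num⟩
  have hg : (0.4339 : ℝ) < gadgetProb (0.0738 : ℝ) 5 (2 * 4 - 1) := by
    rw [gadgetProb]
    norm_num [Finset.sum_range_succ]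
  have := siteCriticalProb_zd_succ_le_of_crossover (d := 4) (by norm_num) 5 ⟨0.0738, hq⟩
    ((siteCriticalProb_zd4_le_of_wierman hW).trans_lt hg)
  refine this.trans ?_
  norm_num

/-- **`p_c^site(ℤ^d) ≤ 0.4153` for every `d ≥ 5`, conditional on Wierman's bound.**
[cite: GomesPereiraSanchis2026, Theorem 3 and §5 table] -/
theorem siteCriticalProb_zd_le_of_wierman_of_five_le (hW : Wierman1995SquareSite) {d : ℕ} (hd : 5 ≤ d) :
    siteCriticalProb (zdGraph d) (0 : Site d) ≤ 0.4153 :=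
  (AxisGrouping.siteCriticalProb_zd_anti hd).trans (siteCriticalProb_zd5_le_of_wierman hW)

/-- **`p_c^site(ℤ^{2m}) ≤ 1 - 0.320508^{1/m}`, conditional on Wierman's bound** (Gomes–Pereira–Sanchis,
Theorem 3(1): `p_c^s(d) ≤ 1 - (0,32)^{2/d}` for even `d`, from Lemma 2 with `k = 2` and
`p_c^s(ℤ²) ≤ 0.68`; here with `1 - 0.679492 = 0.320508`).
[cite: GomesPereiraSanchis2026, Theorem 3(1)] [cite: Wierman1995, main theorem] -/
theorem siteCriticalProb_zd_two_mul_le_of_wierman (hW : Wierman1995SquareSite) (m : ℕ) [NeZero m] :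
    siteCriticalProb (zdGraph (2 * m)) (0 : Site (2 * m)) ≤ 1 - (0.320508 : ℝ) ^ ((m : ℝ)⁻¹) := by
  have hr0 : 0 ≤ (0.320508 : ℝ) ^ ((m : ℝ)⁻¹) := Real.rpow_nonneg (by norm_num) _
  have hr1 : (0.320508 : ℝ) ^ ((m : ℝ)⁻¹) ≤ 1 := Real.rpow_le_one (by norm_num) (by norm_num) (by positivity)
  refine AxisGrouping.siteCriticalProb_zd_mul_le_real (k := 2) (m := m) (by linarith) fun t ht ht1 => ?_
  have hlt : (1 - t) ^ m < 0.320508 := by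
    have h1 : 1 - t < (0.320508 : ℝ) ^ ((m : ℝ)⁻¹) := by linarith
    have h2 : 0 ≤ 1 - t := by linarith
    calc (1 - t) ^ m < ((0.320508 : ℝ) ^ ((m : ℝ)⁻¹)) ^ m := pow_lt_pow_left₀ h1 h2 (NeZero.ne m)
      _ = 0.320508 := Real.rpow_inv_natCast_pow (by norm_num) (NeZero.ne m)
  have hW' : siteCriticalProb (zdGraph 2) (0 : Site 2) ≤ 0.679492 := hW
  linarith

/-- **`p_c^site(ℤ⁸) ≤ 0.2476`, conditional on Wierman's bound** (Theorem 3(1) at `d = 8`: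
`1 - 0.320508^{1/4} = 0.24758…`; the printed `0.2479` uses `0.32`; the unconditional kernel bound is
`0.271`, `GPSCrossover.siteCriticalProb_zd8_le_crossover`).
[cite: GomesPereiraSanchis2026, Theorem 3(1) and §5 table (site, d = 8: 0,2479)] -/
theorem siteCriticalProb_zd8_le_of_wierman (hW : Wierman1995SquareSite) :
    siteCriticalProb (zdGraph 8) (0 : Site 8) ≤ 0.2476 := by
  have h := AxisGrouping.siteCriticalProb_zd_mul_le_real (k := 2) (m := 4) (t₀ := 0.2476) (by norm_num)
    fun t ht ht1 => by
      have hW' : siteCriticalProb (zdGraph 2) (0 : Site 2) ≤ 0.679492 := hW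
      have h0 : 0 ≤ 1 - t := by linarith
      have h4 : (1 - t) ^ 4 < (0.7524 : ℝ) ^ 4 := pow_lt_pow_left₀ (by linarith) h0 (by norm_num)
      norm_num at h4
      linarith
  exact h

/-- **`p_c^site(ℤ^d) ≤ 0.2476` for every `d ≥ 8`, conditional on Wierman's bound.**
[cite: GomesPereiraSanchis2026, Theorem 3 and §5 table (site, d = 8)] -/
theorem siteCriticalProb_zd_le_of_wierman_of_eight_le (hW : Wierman1995SquareSite) {d : ℕ} (hd : 8 ≤ d) :
    siteCriticalProb (zdGraph d) (0 : Site d) ≤ 0.2476 :=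
  (AxisGrouping.siteCriticalProb_zd_anti hd).trans (siteCriticalProb_zd8_le_of_wierman hW)

end GPSCrossover

end Literature.Probability.Percolation

end
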